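import Mathlib
import Summits.KontsevichZagierPeriods.Zeta5Search.TwoTaleOmega.FormalBarnesT

/-!
# Formal Barnes functionals — the STEP LEMMA (blueprint F8, generic part)

HONEST FRAMING: systematic search; no irrationality claim unless certified. Pure finite algebra over `ℚ`; no named
fact, no `sorry`.

This file packages, once and for all, the passage

  DATA identity `Σ_{k<4} c_k · v_k = S^h G − G`  ⟹  functional identity `Σ_k c_k Λ_s[v_k] = (residues of G at s)`
  ⟹  (node bookkeeping) `Σ_k c_k Λ_{s+n_k}[v_k] = (residues of G) + Σ_k c_k · (crossing residues of v_k)`,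

for both tales (`h = 1`: `lam0 / lam1` with `rho0 / rho1`; `h = 2`: `altE0 / altE1` with `altRes0 / altRes1`), so that a
per-direction instance of the (bmiss)@Ω recurrence (RECURRENCE.md §13.10) only has to supply: the four data `v_k =
data(F(p + kδ))`, the telescoped data `G` (built with `PF.mulLin / divLin / mulCoeffs`), the data identity (from Lemma U,
`PF.eq_of_eval_eq`), the node offsets `n_k`, and the explicit rational identity "residues of `G` + node-move residues = 0"
(§13.10 (5)) — and then reads off the recurrence of the linear forms through `link_formQ / link_formP` (tale 1) or
`link_formQT / link_formPT` (tale 2).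

## Main statements
* `PF.comb4 c v` — the telescoper combination `Σ_{k<4} c_k · v_k` of four data; `lam•_comb4`, `altE•_comb4` — linearity.
* `lam0_step`, `lam1_step` — tale 1: data identity with `G.shift` ⟹ `Σ c_k Λ_s[v_k] = ρ_s(G)`.
* `altE0_step2`, `altE1_step2` — tale 2: data identity with `G.shift.shift` ⟹ `Σ c_k E_M[v_k] = −(σ_M + σ_{M+1})(G)`.
* `lam0_recurrence`, `lam1_recurrence`, `altE0_recurrence`, `altE1_recurrence` — the same with each `v_k` evaluated at
  its OWN node `s + n_k` (`n_k : ℕ`; take `s` = the leftmost node), the node moves contributing their crossing residues.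
* `…_recurrence_zero` — the recurrence `Σ c_k Λ_{s+n_k}[v_k] = 0` from the single rational identity (5).
-/

open Finset

noncomputable section -- lane edit (lead/lit g13): PF data combinators are noncomputable in the landed FormalBarnes* files

namespace Summit.KontsevichZagierPeriods.Zeta5Search.FormalBarnes

namespace PF

/-- The telescoper combination `Σ_{k<4} c_k · v_k` of four data. -/
def comb4 (c : Fin 4 → ℚ) (v : Fin 4 → PF) : PF :=
  (((v 0).smul (c 0)).add ((v 1).smul (c 1))).add (((v 2).smul (c 2)).add ((v 3).smul (c 3)))

end PF

/-! ### Linearity over the combination -/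

/-- `Λ⁰_s` is linear over `comb4`. -/
theorem lam0_comb4 (d : ℕ) (s : ℤ) (c : Fin 4 → ℚ) (v : Fin 4 → PF) :
    lam0 d s (PF.comb4 c v) = ∑ k : Fin 4, c k * lam0 d s (v k) := by
  simp only [PF.comb4, lam0_add, lam0_smul, Fin.sum_univ_four]
  ring

/-- `Λ¹_s` is linear over `comb4`. -/
theorem lam1_comb4 (s : ℤ) (c : Fin 4 → ℚ) (v : Fin 4 → PF) :
    lam1 s (PF.comb4 c v) = ∑ k : Fin 4, c k * lam1 s (v k) := by
  simp only [PF.comb4, lam1_add, lam1_smul, Fin.sum_univ_four]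
  ring

/-- `E⁰_M` is linear over `comb4`. -/
theorem altE0_comb4 (d : ℕ) (M : ℤ) (c : Fin 4 → ℚ) (v : Fin 4 → PF) :
    altE0 d M (PF.comb4 c v) = ∑ k : Fin 4, c k * altE0 d M (v k) := by
  simp only [PF.comb4, altE0_add, altE0_smul, Fin.sum_univ_four]
  ring

/-- `E¹_M` is linear over `comb4`. -/
theorem altE1_comb4 (M : ℤ) (c : Fin 4 → ℚ) (v : Fin 4 → PF) :
    altE1 M (PF.comb4 c v) = ∑ k : Fin 4, c k * altE1 M (v k) := by
  simp only [PF.comb4, altE1_add, altE1_smul, Fin.sum_univ_four]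
  ring

/-! ### The step lemma: data identity ⟹ functional identity -/

/-- **Step lemma, tale 1, `1`-coordinate**: if `Σ c_k v_k = S G − G` as data, then `Σ c_k Λ⁰_s[v_k] = ρ⁰_s(G)`
(for any truncation `d` bounding `deg poly(G)`). -/
theorem lam0_step (d : ℕ) (s : ℤ) (c : Fin 4 → ℚ) (v : Fin 4 → PF) (G : PF)
    (hdata : PF.comb4 c v = G.shift.add (G.smul (-1))) (hd : G.poly.natDegree ≤ d) :
    ∑ k : Fin 4, c k * lam0 d s (v k) = rho0 s G := by
  rw [← lam0_comb4, hdata, lam0_add, lam0_smul]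
  have h := lam0_telescope d s G.shift G rfl hd
  linarith

/-- **Step lemma, tale 1, `ζ(2)`-coordinate**: if `Σ c_k v_k = S G − G` as data, then `Σ c_k Λ¹_s[v_k] = ρ¹_s(G)`. -/
theorem lam1_step (s : ℤ) (c : Fin 4 → ℚ) (v : Fin 4 → PF) (G : PF)
    (hdata : PF.comb4 c v = G.shift.add (G.smul (-1))) :
    ∑ k : Fin 4, c k * lam1 s (v k) = rho1 s G := by
  rw [← lam1_comb4, hdata, lam1_add, lam1_smul]
  have h := lam1_telescope s G.shift G rfl
  linarith

/-- **Step lemma, tale 2, `1`-coordinate**: if `Σ c_k v_k = S² G − G` as data (`S²` = Zudilin's `t ↦ t + 1` in the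
variable `u = 2t`), then `Σ c_k E⁰_M[v_k] = −(σ⁰_M(G) + σ⁰_{M+1}(G))`. -/
theorem altE0_step2 (d : ℕ) (M : ℤ) (c : Fin 4 → ℚ) (v : Fin 4 → PF) (G : PF)
    (hdata : PF.comb4 c v = G.shift.shift.add (G.smul (-1))) (hd : G.poly.natDegree ≤ d) :
    ∑ k : Fin 4, c k * altE0 d M (v k) = -(altRes0 M G + altRes0 (M + 1) G) := by
  rw [← altE0_comb4, hdata, altE0_add, altE0_smul]
  have h := altE0_telescope2 d M G.shift.shift G rfl hd
  linarith

/-- **Step lemma, tale 2, `η₂`-coordinate**: if `Σ c_k v_k = S² G − G` as data, then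
`Σ c_k E¹_M[v_k] = −(σ¹_M(G) + σ¹_{M+1}(G))`. -/
theorem altE1_step2 (M : ℤ) (c : Fin 4 → ℚ) (v : Fin 4 → PF) (G : PF)
    (hdata : PF.comb4 c v = G.shift.shift.add (G.smul (-1))) :
    ∑ k : Fin 4, c k * altE1 M (v k) = -(altRes1 M G + altRes1 (M + 1) G) := by
  rw [← altE1_comb4, hdata, altE1_add, altE1_smul]
  have h := altE1_telescope2 M G.shift.shift G rfl
  linarith

/-! ### Node bookkeeping: each `v_k` at its own node `s + n_k`

Take `s` = the leftmost of the four nodes, `n_k : ℕ` the offsets. The functional at the own node differs from the one at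
`s` by the crossing residues in between (`lam•_move`, `altE•_move`); in most directions these vanish term by term
(`lam•_move_eq`), but NOT always (RECURRENCE.md §13.11: direction `b` and `a`, second tale), so the recurrence is stated
against the SUM of the residues of `G` and the node-move residues. -/

/-- **Recurrence shape, tale 1, `1`-coordinate**:
`Σ c_k Λ⁰_{s+n_k}[v_k] = ρ⁰_s(G) + Σ c_k Σ_{i<n_k} ρ⁰_{s+i}(v_k)`. -/
theorem lam0_recurrence (d : ℕ) (s : ℤ) (c : Fin 4 → ℚ) (v : Fin 4 → PF) (G : PF) (n : Fin 4 → ℕ)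
    (hdata : PF.comb4 c v = G.shift.add (G.smul (-1))) (hd : G.poly.natDegree ≤ d)
    (hdk : ∀ k, (v k).poly.natDegree ≤ d) :
    ∑ k : Fin 4, c k * lam0 d (s + n k) (v k)
      = rho0 s G + ∑ k : Fin 4, c k * ∑ i ∈ range (n k), rho0 (s + i) (v k) := by
  rw [← lam0_step d s c v G hdata hd, ← sum_add_distrib]
  refine sum_congr rfl fun k _ => ?_
  have h := lam0_move d s (v k) (hdk k) (n k)
  linear_combination c k * h

/-- **Recurrence shape, tale 1, `ζ(2)`-coordinate**:
`Σ c_k Λ¹_{s+n_k}[v_k] = ρ¹_s(G) + Σ c_k Σ_{i<n_k} ρ¹_{s+i}(v_k)`. -/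
theorem lam1_recurrence (s : ℤ) (c : Fin 4 → ℚ) (v : Fin 4 → PF) (G : PF) (n : Fin 4 → ℕ)
    (hdata : PF.comb4 c v = G.shift.add (G.smul (-1))) :
    ∑ k : Fin 4, c k * lam1 (s + n k) (v k)
      = rho1 s G + ∑ k : Fin 4, c k * ∑ i ∈ range (n k), rho1 (s + i) (v k) := by
  rw [← lam1_step s c v G hdata, ← sum_add_distrib]
  refine sum_congr rfl fun k _ => ?_
  have h := lam1_move s (v k) (n k)
  linear_combination c k * h

/-- **Recurrence shape, tale 2, `1`-coordinate** (node moves to the RIGHT lower `E` by the crossing residues):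
`Σ c_k E⁰_{M+n_k}[v_k] = −(σ⁰_M + σ⁰_{M+1})(G) − Σ c_k Σ_{i<n_k} σ⁰_{M+i}(v_k)`. -/
theorem altE0_recurrence (d : ℕ) (M : ℤ) (c : Fin 4 → ℚ) (v : Fin 4 → PF) (G : PF) (n : Fin 4 → ℕ)
    (hdata : PF.comb4 c v = G.shift.shift.add (G.smul (-1))) (hd : G.poly.natDegree ≤ d)
    (hdk : ∀ k, (v k).poly.natDegree ≤ d) :
    ∑ k : Fin 4, c k * altE0 d (M + n k) (v k)
      = -(altRes0 M G + altRes0 (M + 1) G) - ∑ k : Fin 4, c k * ∑ i ∈ range (n k), altRes0 (M + i) (v k) := by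
  rw [← altE0_step2 d M c v G hdata hd, ← sum_sub_distrib]
  refine sum_congr rfl fun k _ => ?_
  have h := altE0_move d M (v k) (hdk k) (n k)
  linear_combination (-(c k)) * h

/-- **Recurrence shape, tale 2, `η₂`-coordinate**:
`Σ c_k E¹_{M+n_k}[v_k] = −(σ¹_M + σ¹_{M+1})(G) − Σ c_k Σ_{i<n_k} σ¹_{M+i}(v_k)`. -/
theorem altE1_recurrence (M : ℤ) (c : Fin 4 → ℚ) (v : Fin 4 → PF) (G : PF) (n : Fin 4 → ℕ)
    (hdata : PF.comb4 c v = G.shift.shift.add (G.smul (-1))) :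
    ∑ k : Fin 4, c k * altE1 (M + n k) (v k)
      = -(altRes1 M G + altRes1 (M + 1) G) - ∑ k : Fin 4, c k * ∑ i ∈ range (n k), altRes1 (M + i) (v k) := by
  rw [← altE1_step2 M c v G hdata, ← sum_sub_distrib]
  refine sum_congr rfl fun k _ => ?_
  have h := altE1_move M (v k) (n k)
  linear_combination (-(c k)) * h

/-! ### The recurrence from the single rational identity (§13.10 (5)) -/

/-- Tale 1, `1`-coordinate: the legitimacy identity `ρ⁰_s(G) + Σ c_k·(node-move residues) = 0` gives the recurrence
`Σ c_k Λ⁰_{s+n_k}[v_k] = 0`. -/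
theorem lam0_recurrence_zero (d : ℕ) (s : ℤ) (c : Fin 4 → ℚ) (v : Fin 4 → PF) (G : PF) (n : Fin 4 → ℕ)
    (hdata : PF.comb4 c v = G.shift.add (G.smul (-1))) (hd : G.poly.natDegree ≤ d)
    (hdk : ∀ k, (v k).poly.natDegree ≤ d)
    (h5 : rho0 s G + ∑ k : Fin 4, c k * ∑ i ∈ range (n k), rho0 (s + i) (v k) = 0) :
    ∑ k : Fin 4, c k * lam0 d (s + n k) (v k) = 0 := by
  rw [lam0_recurrence d s c v G n hdata hd hdk, h5]

/-- Tale 1, `ζ(2)`-coordinate: `ρ¹_s(G) + Σ c_k·(node-move residues) = 0` gives `Σ c_k Λ¹_{s+n_k}[v_k] = 0`. -/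
theorem lam1_recurrence_zero (s : ℤ) (c : Fin 4 → ℚ) (v : Fin 4 → PF) (G : PF) (n : Fin 4 → ℕ)
    (hdata : PF.comb4 c v = G.shift.add (G.smul (-1)))
    (h5 : rho1 s G + ∑ k : Fin 4, c k * ∑ i ∈ range (n k), rho1 (s + i) (v k) = 0) :
    ∑ k : Fin 4, c k * lam1 (s + n k) (v k) = 0 := by
  rw [lam1_recurrence s c v G n hdata, h5]

/-- Tale 2, `1`-coordinate: `(σ⁰_M + σ⁰_{M+1})(G) + Σ c_k·(node-move residues) = 0` gives `Σ c_k E⁰_{M+n_k}[v_k] = 0`. -/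
theorem altE0_recurrence_zero (d : ℕ) (M : ℤ) (c : Fin 4 → ℚ) (v : Fin 4 → PF) (G : PF) (n : Fin 4 → ℕ)
    (hdata : PF.comb4 c v = G.shift.shift.add (G.smul (-1))) (hd : G.poly.natDegree ≤ d)
    (hdk : ∀ k, (v k).poly.natDegree ≤ d)
    (h5 : altRes0 M G + altRes0 (M + 1) G + ∑ k : Fin 4, c k * ∑ i ∈ range (n k), altRes0 (M + i) (v k) = 0) :
    ∑ k : Fin 4, c k * altE0 d (M + n k) (v k) = 0 := by
  rw [altE0_recurrence d M c v G n hdata hd hdk]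
  linarith

/-- Tale 2, `η₂`-coordinate: `(σ¹_M + σ¹_{M+1})(G) + Σ c_k·(node-move residues) = 0` gives `Σ c_k E¹_{M+n_k}[v_k] = 0`. -/
theorem altE1_recurrence_zero (M : ℤ) (c : Fin 4 → ℚ) (v : Fin 4 → PF) (G : PF) (n : Fin 4 → ℕ)
    (hdata : PF.comb4 c v = G.shift.shift.add (G.smul (-1)))
    (h5 : altRes1 M G + altRes1 (M + 1) G + ∑ k : Fin 4, c k * ∑ i ∈ range (n k), altRes1 (M + i) (v k) = 0) :
    ∑ k : Fin 4, c k * altE1 (M + n k) (v k) = 0 := by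
  rw [altE1_recurrence M c v G n hdata]
  linarith

end Summit.KontsevichZagierPeriods.Zeta5Search.FormalBarnes
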